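import Summits.BirchSwinnertonDyer.Rank1Residual.X11b.KolyvaginShaExponentAtPrime
import Summits.BirchSwinnertonDyer.Rank1Residual.X11b.Three.KolyvaginShaFiniteThreeClass
import Summits.BirchSwinnertonDyer.Rank1Residual.X11b.HeegnerPointScaling
import HarnessLib

/-!
# X11b @ 3: `3^{2m} · Ш(E/K)[3^∞] = 0` for `3^{m+1} ∤ y_K` — the QUANTITATIVE (exponent-form)
# telescope AT `3`, on `3 ‖ N_E` (SIX labels) and on `ClassX11b W 3` ∩ (KN₃)/ℚ (FIVE labels, no
# image hypothesis); `3 ∤ y_K ⟹ Ш(E/K)[3^∞] = 0`; the Heegner-INDEX form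

Cell `b2b-bsdres`, team x11b3 (N8/O2); seat x11b3-p2 GEN 36 ((P2-QUANT)), the quantitative
companion of FILE 4 / FILE 5 / FILE 6 of LEAD DEAL #30 (`X11b/Three/KolyvaginShaFiniteThree{,Rat,Class}`,
p323681 / p324972 / p325613).  Summit-side THEOREM-ONLY file (no definition, no named fact, no
`sorry`); `K : Type`; the literal prime `3`.

HONEST FRAMING (binding): **plumbing — COMPOSITIONS of tree theorems, nothing discharged.**  The
telescopes of record AT `3` conclude "`Ш(E/K)[3^∞]` is finite" from the cite-only inputs {`hPT`,
`hrec`, `hCM₃`, `h53₃`, (`hGZ₃`), `hγ₃`}.  The descent behind them proves Kolyvagin's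
annihilation with McCallum's exponent `M₀ = ord_3 [E(K) : ℤ y_K]` (Lemma 5.1), exported per prime
by `KolyvaginAssembly.pow_smul_sha_primary_eq_zero_at_of_leafInputs_of_poitouTate`
(`X11b/KolyvaginShaExponentAtPrime`, this seat).  THIS FILE reads it at `p = 3` exactly as FILE 4 /
FILE 6 read p323190: for `K` imaginary quadratic with the Heegner hypothesis, `P = y_K` a
non-torsion Heegner point and every `m` with `3^{m+1} ∤ P` in `E(K)`:
**`3^{2m} · Ш(E/K)[3^∞] = 0`** — on `3 ‖ N_E` with `ρ̄_{E,3}` onto from SIX labels (`¬ CM` and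
`d_K ∉ {−3, −4}` SUPPLIED as in FILE 4), and on `ClassX11b W 3` ∩ (KN₃)/ℚ from FIVE labels with
NO image hypothesis (`hGZ₃` by `KolyvaginHloc.hGZ_of_kodairaNeron_three_rat`, p322007; `Surj(3)`
by `surj_three_of_classX11b_of_kodairaNeron_rat`, p325613).  Corollaries on the class: `3 ∤ y_K`
in `E(K)` ⟹ `Ш(E/K)[3^∞] = 0` (Gross 1991 Prop. 2.1 (2) at `p = 3`, from the mod-`3^M` leaves);
and the Heegner-INDEX form `3^{2·ord_3 [E(K) : ℤ y_K]} · Ш(E/K)[3^∞] = 0` for `[E(K) : ℤ y_K]`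
finite (McCallum Lemma 5.1's bookkeeping: `3^{m+1} ∣ y_K ⟹ 3^{m+1} ∣ [E(K) : ℤ y_K]`, tree
`X11b.index_zmultiples_zsmul`) — the EXPONENT form of the named fact
`Kolyvagin1990_padicValNat_card_sha_le` (binder `hB` of `bsdp_of_classX11b_three_of_onTreeInputs`)
at `p = 3` on this class.  The ORDER form (`ord_3 #Ш(E/K) ≤ 2 ord_3 [E(K) : ℤ y_K]`, McCallum §1
Theorem as printed) is NOT obtained and `hB` is NOT discharged: Kolyvagin's order bound uses his
classes `τ_λ(M)` for `λ ∈ Λ^r`, ALL `r` (*Euler systems* (1990) Thm. A; ICM 1990 §2), while the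
tree's descent is Gross's §10 (`r ≤ 2`).  Every label is the corresponding binder of FILE 4 /
FILE 6 token for token; cite-only, NOT Literature facts, NOT discharged; nothing booked; no mark /
label / count / tier moves; node `Three.HsiehDescentAt₃` and its FOUR antecedents untouched;
#(KN₃) not asserted.

## What is proved (namespace `…X11b.Three`)

* `pow_smul_sha_three_primary_eq_zero_of_leafInputs_of_poitouTate` — `3 ‖ N_E` (`hmult`), SIX
  labels {`hPT`, `hrec`, `hCM`, `h53`, `hGZ`, `hγ`} at `3` + `hN`: for `ρ̄_{E,3}` onto and
  `3^{m+1} ∤ P`, `3^{2m} Ш(E/K)[3^∞] = 0`.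
* `pow_smul_sha_three_primary_eq_zero_of_classX11b_of_kodairaNeron_rat'` — `ClassX11b W 3` ∩
  (KN₃)/ℚ, FIVE labels {`hPT`, `hrec`, `hCM`, `h53`, `hγ`} at `3` + `hN`, NO image hypothesis.
* `sha_three_primary_eq_zero_of_classX11b_of_kodairaNeron_rat_of_not_dvd` — same class and
  labels: `3 ∤ P` in `E(K)` ⟹ `Ш(E/K)[3^∞] = 0`.
* `pow_smul_sha_three_primary_eq_zero_of_classX11b_of_kodairaNeron_rat_index` — same class and
  labels, `[E(K) : ℤ P] ≠ 0`: `3^{2·ord_3 [E(K) : ℤ P]} Ш(E/K)[3^∞] = 0`.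

## References

* [McCallumLMS1991] W. G. McCallum, LMS LNS 153 (1991), §1 Theorem (Kolyvagin) (p. 296), Lemma 5.1
  (p. 303) (held `book:editornd-l-functions-arithmetic`, PDF pp. 277, 284).
* [GrossLMS1991] B. H. Gross, same volume, Thm. 1.3 (2), Prop. 2.1 (2), §§3–8, §10 (held).
* [Kolyvagin1990] V. A. Kolyvagin, *Euler systems* (1990), Thm. A (cite only; acq-00132); Proc. ICM
  Kyoto 1990, vol. I, 429–436, §2 (read, galaxy).
* [Serre1972] §2.4 Prop. 15; [SilvermanATAEC1994] II.6.4, V.6 Prop. 6.1; [SilvermanAEC2009]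
  VII.5.4 (a), VII.6.1; [MilneADT2006] Ch. I Thm. 4.10(b).

presearch: quantitative telescope at 3 → `lean search 'pow_smul_sha_three'` → none; McCallum §1 /
Lemma 5.1 [corpus:book:editornd-l-functions-arithmetic pp. 296, 303]; nothing minted.
-/

noncomputable section

open scoped Classical
open WeierstrassCurve Field NumberField IsDedekindDomain
open Literature.NumberTheory.EllipticCurves Literature.NumberTheory.GaloisRepresentations
open Literature.NumberTheory.EllipticCurves.Rank1Residual
open Literature.NumberTheory.EllipticCurves.RingClassField
open Literature.NumberTheory.EllipticCurves.ModularForms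
open Literature.NumberTheory.DiophantineGeometry Literature.NumberTheory.DiophantineGeometry.TateAlgorithm
open Summit.BirchSwinnertonDyer.Rank1Residual.X11b.KolyvaginAssembly

namespace Summit.BirchSwinnertonDyer.Rank1Residual.X11b.Three

-- `K : Type`: the tree's ring-class class field theory is universe `0`.
variable {K : Type} [Field K] [NumberField K] {N : ℕ} {W : WeierstrassCurve ℚ}

/-- **`3^{2m} · Ш(E/K)[3^∞] = 0` on `3 ‖ N_E` from SIX cite-only inputs AT `3`, for every `m` with
`3^{m+1} ∤ y_K` in `E(K)`** — the quantitative per-prime telescope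
`KolyvaginAssembly.pow_smul_sha_primary_eq_zero_at_of_leafInputs_of_poitouTate` at `p = 3` with
`¬ CM` (from `hmult`, Silverman *ATAEC* II.6.4) and `d_K ∉ {−3, −4}` (from `3 ∣ N_E` and the
Heegner hypothesis, `KolyvaginHexc.discr_ne_of_satisfiesHeegnerHypothesis_of_three_dvd`) SUPPLIED,
exactly as FILE 4's `sha_primary_finite_three_of_leafInputs_of_poitouTate` (p323681), whose binders
these are VERBATIM.  CONDITIONAL on EXACTLY {`hPT`, `hrec`, `hCM`, `h53`, `hGZ`, `hγ`} at `3` +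
`hN` + `hmult`; cite-only, NOT facts, NOT discharged; nothing booked.  Conclusion: for `K`
imaginary quadratic with the Heegner hypothesis, `P` a non-torsion Heegner point, `ρ̄_{E,3}` onto
and `3^{m+1} ∤ P`, every class of `Ш(E/K)[3^∞]` is killed by `3^{2m}` (McCallum §1 Theorem in
EXPONENT form; Lemma 5.1). [cite: McCallumLMS1991, §1 Theorem (Kolyvagin), Lemma 5.1]
[cite: GrossLMS1991, Thm. 1.3 (2), §§3–8, §10] [cite: SilvermanATAEC1994, Thm. II.6.4] -/
theorem pow_smul_sha_three_primary_eq_zero_of_leafInputs_of_poitouTate [NeZero N]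
    [W.IsGloballyMinimal]
    (hPT : Literature.NumberTheory.GaloisCohomology.poitouTate_sum_localTatePairing_eq_zero K)
    (hN : ∀ [W.IsElliptic], N = W.conductorNorm ℤ)
    (hmult : W.HasMultiplicativeReductionAtPrime 3)
    (hrec : heegnerPointOfConductor_one_galoisConj N W K)
    (hCM : ∀ [W.IsElliptic] (_hK : IsImaginaryQuadratic K) (_hH : SatisfiesHeegnerHypothesis N K)
      (Dt : ModularParametrizationData W N) (β : ℤ) (ι : K →+* ℂ),
      (4 * N : ℤ) ∣ β ^ 2 - NumberField.discr K →
      ∀ {M : ℕ}, 1 ≤ M → ∀ (m : ℕ), Squarefree m →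
      (∀ q ∈ m.primeFactors, IsKolyvaginPrime N W K 3 q ∧ FrobEqFrobInfty W K (3 ^ M) q) →
      ∃ y : (W.baseChange (ringClassField K ι m)).toAffine.Point,
        WeierstrassCurve.Affine.Point.map (W' := W) (ringClassField K ι m).subtype.toRatAlgHom y =
          heegnerPointComplexOfConductor Dt (NumberField.discr K) β m)
    (h53 : ∀ [W.IsElliptic] (_hK : IsImaginaryQuadratic K) (_hH : SatisfiesHeegnerHypothesis N K)
      (Dt : ModularParametrizationData W N) (β : ℤ) (ι : K →+* ℂ) {M : ℕ}
      (_hM : 1 ≤ M) {n : ℕ} (_hn : Squarefree n)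
      (_hKol : ∀ q ∈ n.primeFactors, IsKolyvaginPrime N W K 3 q ∧ FrobEqFrobInfty W K (3 ^ M) q)
      (d : (m : ℕ) → m ∣ n → KolyvaginHeegnerData Dt β ι m) (m : ℕ) (hm : m ∣ n)
      (τm : ringClassField K ι m ≃ₐ[ℚ] ringClassField K ι m),
      (∀ x : ringClassField K ι m, ((τm x : ringClassField K ι m) : ℂ) = starRingEnd ℂ x) →
      ∃ σ' ∈ ringClassGal ι m, IsOfFinAddOrder
        (pointGalHom W (ringClassField K ι m) τm (d m hm).y -
          (-W.rootNumber) • pointGalHom W (ringClassField K ι m) σ' (d m hm).y))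
    (hGZ : ∀ [W.IsElliptic] (_hK : IsImaginaryQuadratic K) (_hH : SatisfiesHeegnerHypothesis N K)
      (Dt : ModularParametrizationData W N) (β : ℤ) (ι : K →+* ℂ) {M : ℕ} (_hM : 1 ≤ M) {n : ℕ}
      (_hn : Squarefree n)
      (_hKol : ∀ q ∈ n.primeFactors, IsKolyvaginPrime N W K 3 q ∧ FrobEqFrobInfty W K (3 ^ M) q)
      (d : (m : ℕ) → m ∣ n → KolyvaginHeegnerData Dt β ι m),
      ∃ n' : ℤ, IsCoprime ((3 ^ M : ℕ) : ℤ) n' ∧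
        ∀ (m : ℕ) (hm : m ∣ n) (γ : ringClassField K ι m ≃ₐ[ℚ] ringClassField K ι m),
          γ ∈ ringClassGal ι m → ∀ v : HeightOneSpectrum (𝓞 K),
            ¬ (W.baseChange K).HasGoodReductionAt v →
            n' • pointsMap (W.baseChange K) (v.adicCompletion K)
                ((d m hm).toGeomPoints (pointGalHom W (ringClassField K ι m) γ (d m hm).y)) ∈
              E0Receptacle (W.baseChange K) v ∧
            ∀ (ℓ : ℕ) (hℓ : ℓ ∈ m.primeFactors)
              (hle : ringClassField K ι (m / ℓ) ≤ ringClassField K ι m),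
              n' • pointsMap (W.baseChange K) (v.adicCompletion K)
                  ((d m hm).toGeomPoints (pointGalHom W (ringClassField K ι m) γ
                    (WeierstrassCurve.Affine.Point.map (W' := W)
                      ((RingClassField.inclusion ι hle).restrictScalars ℚ)
                      (d (m / ℓ)
                        ((Nat.div_dvd_of_dvd (Nat.dvd_of_mem_primeFactors hℓ)).trans hm)).y))) ∈
                E0Receptacle (W.baseChange K) v)
    (hγ : ∀ [W.IsElliptic] (_hK : IsImaginaryQuadratic K) (_hH : SatisfiesHeegnerHypothesis N K)
      (Dt : ModularParametrizationData W N) (β : ℤ) (ι : K →+* ℂ) {M : ℕ}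
      (_hM : 1 ≤ M) {n : ℕ} (_hn : Squarefree n)
      (_hKol : ∀ q ∈ n.primeFactors, IsKolyvaginPrime N W K 3 q ∧ FrobEqFrobInfty W K (3 ^ M) q)
      (d : (m : ℕ) → m ∣ n → KolyvaginHeegnerData Dt β ι m)
      (m : ℕ) (hm : m ∣ n) (ℓ : ℕ) (hℓ : ℓ ∈ m.primeFactors) [Fact ℓ.Prime]
      (hΔ : ¬ (ℓ : ℤ) ∣ minimalDiscriminantInt W) (φ₀ : absoluteGaloisGroup (ZMod ℓ)),
      (∀ x : AlgebraicClosure (ZMod ℓ), φ₀ • x = x ^ ℓ) →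
      ∀ (hle : ringClassField K ι (m / ℓ) ≤ ringClassField K ι m)
        (γ : ringClassField K ι m ≃ₐ[ℚ] ringClassField K ι m), γ ∈ ringClassGal ι m →
        geomReduction hΔ ((RatClosure.pointsEquiv (K := K) W).symm
            ((d m hm).toGeomPoints (pointGalHom W (ringClassField K ι m) γ (d m hm).y))) =
          φ₀ • geomReduction hΔ ((RatClosure.pointsEquiv (K := K) W).symm
            ((d m hm).toGeomPoints (pointGalHom W (ringClassField K ι m) γ
              (WeierstrassCurve.Affine.Point.map (W' := W)
                ((RingClassField.inclusion ι hle).restrictScalars ℚ)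
                (d (m / ℓ)
                  ((Nat.div_dvd_of_dvd (Nat.dvd_of_mem_primeFactors hℓ)).trans hm)).y))))) :
    ∀ [W.IsElliptic] (_hK : IsImaginaryQuadratic K) (_hH : SatisfiesHeegnerHypothesis N K)
      {P : (W.baseChange K).toAffine.Point} (_hP : IsHeegnerPoint N W K P)
      (_hnt : ¬ IsOfFinAddOrder P) (_hρ : W.HasSurjectiveModNGaloisRep 3) {m : ℕ}
      (_hm : ∀ Q : (W.baseChange K).toAffine.Point, 3 ^ (m + 1) • Q ≠ P) (c : (W.baseChange K).sha),
      (∃ j : ℕ, 3 ^ j • c = 0) → 3 ^ (2 * m) • c = 0 := by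
  intro _ hK hH P hP hnt hρ m hm
  have h3 : 3 ∣ N := by
    rw [hN]
    exact (W.dvd_conductorNorm_iff_not_hasGoodReductionAtPrime 3).mpr
      (not_hasGoodReductionAtPrime_of_hasMultiplicativeReductionAtPrime 3 hmult)
  have hE : ¬ W.HasCM := fun hCM' ↦ W.not_hasMultiplicativeReductionAtPrime_of_hasCM hCM' 3 hmult
  have hD := KolyvaginHexc.discr_ne_of_satisfiesHeegnerHypothesis_of_three_dvd hK.1 hH h3
  exact pow_smul_sha_primary_eq_zero_at_of_leafInputs_of_poitouTate Nat.prime_three (by decide) hPT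
    hN hrec hCM h53 hGZ hγ hE hK hD hH hP hnt hρ hm

/-- **On the class X11b @ 3 ∩ (KN₃)/ℚ, `3^{2m} · Ш(E/K)[3^∞] = 0` for every `m` with `3^{m+1} ∤ y_K`,
from FIVE cite-only inputs AT `3` — with NO image hypothesis.**
`pow_smul_sha_three_primary_eq_zero_of_leafInputs_of_poitouTate` for `(E, 3) ∈ ClassX11b W 3`
(only `mult(3)` used) with `hGZ₃` SUPPLIED on (KN₃) read off the ℚ-side data by
`KolyvaginHloc.hGZ_of_kodairaNeron_three_rat` (p322007) and `ρ̄_{E,3}` onto SUPPLIED by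
`surj_three_of_classX11b_of_kodairaNeron_rat` (p325613) — exactly as FILE 6's END
`sha_primary_finite_three_of_classX11b_of_kodairaNeron_rat'`, whose binders these are VERBATIM.
For `K` imaginary quadratic with the Heegner hypothesis, `P` a non-torsion Heegner point and
`3^{m+1} ∤ P` in `E(K)`: every class of `Ш(E/K)[3^∞]` is killed by `3^{2m}`.  CONDITIONAL on
EXACTLY {`hPT`, `hrec`, `hCM`, `h53`, `hγ`} at `3` + `hN` + (KN₃)/ℚ (`hKN3m`, `hKN3a`); cite-only,
NOT discharged; nothing booked; no mark / count / tier moves.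
[cite: McCallumLMS1991, §1 Theorem (Kolyvagin), Lemma 5.1] [cite: GrossLMS1991, Thm. 1.3 (2), §10]
[cite: Serre1972, §2.4 Prop. 15] [cite: SilvermanAEC2009, Thm. VII.6.1] -/
theorem pow_smul_sha_three_primary_eq_zero_of_classX11b_of_kodairaNeron_rat' [NeZero N]
    [W.IsGloballyMinimal] (hW : ClassX11b W 3)
    (hPT : Literature.NumberTheory.GaloisCohomology.poitouTate_sum_localTatePairing_eq_zero K)
    (hN : ∀ [W.IsElliptic], N = W.conductorNorm ℤ)
    (hrec : heegnerPointOfConductor_one_galoisConj N W K)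
    (hCM : ∀ [W.IsElliptic] (_hK : IsImaginaryQuadratic K) (_hH : SatisfiesHeegnerHypothesis N K)
      (Dt : ModularParametrizationData W N) (β : ℤ) (ι : K →+* ℂ),
      (4 * N : ℤ) ∣ β ^ 2 - NumberField.discr K →
      ∀ {M : ℕ}, 1 ≤ M → ∀ (m : ℕ), Squarefree m →
      (∀ q ∈ m.primeFactors, IsKolyvaginPrime N W K 3 q ∧ FrobEqFrobInfty W K (3 ^ M) q) →
      ∃ y : (W.baseChange (ringClassField K ι m)).toAffine.Point,
        WeierstrassCurve.Affine.Point.map (W' := W) (ringClassField K ι m).subtype.toRatAlgHom y =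
          heegnerPointComplexOfConductor Dt (NumberField.discr K) β m)
    (h53 : ∀ [W.IsElliptic] (_hK : IsImaginaryQuadratic K) (_hH : SatisfiesHeegnerHypothesis N K)
      (Dt : ModularParametrizationData W N) (β : ℤ) (ι : K →+* ℂ) {M : ℕ}
      (_hM : 1 ≤ M) {n : ℕ} (_hn : Squarefree n)
      (_hKol : ∀ q ∈ n.primeFactors, IsKolyvaginPrime N W K 3 q ∧ FrobEqFrobInfty W K (3 ^ M) q)
      (d : (m : ℕ) → m ∣ n → KolyvaginHeegnerData Dt β ι m) (m : ℕ) (hm : m ∣ n)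
      (τm : ringClassField K ι m ≃ₐ[ℚ] ringClassField K ι m),
      (∀ x : ringClassField K ι m, ((τm x : ringClassField K ι m) : ℂ) = starRingEnd ℂ x) →
      ∃ σ' ∈ ringClassGal ι m, IsOfFinAddOrder
        (pointGalHom W (ringClassField K ι m) τm (d m hm).y -
          (-W.rootNumber) • pointGalHom W (ringClassField K ι m) σ' (d m hm).y))
    (hKN3m : ∀ [W.IsElliptic] (v : HeightOneSpectrum (𝓞 ℚ)),
      W.HasMultiplicativeReductionAt v → ¬ 3 ∣ W.ordMinimalDiscriminant v)
    (hKN3a : ∀ [W.IsElliptic] (v : HeightOneSpectrum (𝓞 ℚ)), W.HasAdditiveReductionAt v →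
      W.kodairaSymbolAt v ≠ KodairaSymbol.IV ∧ W.kodairaSymbolAt v ≠ KodairaSymbol.IVstar)
    (hγ : ∀ [W.IsElliptic] (_hK : IsImaginaryQuadratic K) (_hH : SatisfiesHeegnerHypothesis N K)
      (Dt : ModularParametrizationData W N) (β : ℤ) (ι : K →+* ℂ) {M : ℕ}
      (_hM : 1 ≤ M) {n : ℕ} (_hn : Squarefree n)
      (_hKol : ∀ q ∈ n.primeFactors, IsKolyvaginPrime N W K 3 q ∧ FrobEqFrobInfty W K (3 ^ M) q)
      (d : (m : ℕ) → m ∣ n → KolyvaginHeegnerData Dt β ι m)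
      (m : ℕ) (hm : m ∣ n) (ℓ : ℕ) (hℓ : ℓ ∈ m.primeFactors) [Fact ℓ.Prime]
      (hΔ : ¬ (ℓ : ℤ) ∣ minimalDiscriminantInt W) (φ₀ : absoluteGaloisGroup (ZMod ℓ)),
      (∀ x : AlgebraicClosure (ZMod ℓ), φ₀ • x = x ^ ℓ) →
      ∀ (hle : ringClassField K ι (m / ℓ) ≤ ringClassField K ι m)
        (γ : ringClassField K ι m ≃ₐ[ℚ] ringClassField K ι m), γ ∈ ringClassGal ι m →
        geomReduction hΔ ((RatClosure.pointsEquiv (K := K) W).symm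
            ((d m hm).toGeomPoints (pointGalHom W (ringClassField K ι m) γ (d m hm).y))) =
          φ₀ • geomReduction hΔ ((RatClosure.pointsEquiv (K := K) W).symm
            ((d m hm).toGeomPoints (pointGalHom W (ringClassField K ι m) γ
              (WeierstrassCurve.Affine.Point.map (W' := W)
                ((RingClassField.inclusion ι hle).restrictScalars ℚ)
                (d (m / ℓ)
                  ((Nat.div_dvd_of_dvd (Nat.dvd_of_mem_primeFactors hℓ)).trans hm)).y))))) :
    ∀ [W.IsElliptic] (_hK : IsImaginaryQuadratic K) (_hH : SatisfiesHeegnerHypothesis N K)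
      {P : (W.baseChange K).toAffine.Point} (_hP : IsHeegnerPoint N W K P)
      (_hnt : ¬ IsOfFinAddOrder P) {m : ℕ}
      (_hm : ∀ Q : (W.baseChange K).toAffine.Point, 3 ^ (m + 1) • Q ≠ P) (c : (W.baseChange K).sha),
      (∃ j : ℕ, 3 ^ j • c = 0) → 3 ^ (2 * m) • c = 0 := by
  intro _ hK hH P hP hnt m hm
  exact pow_smul_sha_three_primary_eq_zero_of_leafInputs_of_poitouTate hPT hN hW.2.2.1 hrec hCM h53
    (@fun _ hK hH Dt _ ι _ _ _ hn hKol d ↦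
      KolyvaginHloc.hGZ_of_kodairaNeron_three_rat hK hH ι Dt hn hKol d hKN3m hKN3a) hγ hK hH hP hnt
    (surj_three_of_classX11b_of_kodairaNeron_rat hW hKN3m) hm

/-- **On the class X11b @ 3 ∩ (KN₃)/ℚ: if `3 ∤ y_K` in `E(K)` then `Ш(E/K)[3^∞] = 0`, from FIVE
cite-only inputs AT `3`** — the case `m = 0` of
`pow_smul_sha_three_primary_eq_zero_of_classX11b_of_kodairaNeron_rat'` (Gross 1991 Prop. 2.1 (2)
at `p = 3`: *"the `p`-torsion subgroup `Ш(E/K)_p` is trivial"*, here from the mod-`3^M` leaves).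
Same binders; CONDITIONAL on EXACTLY {`hPT`, `hrec`, `hCM`, `h53`, `hγ`} at `3` + `hN` +
(KN₃)/ℚ; cite-only, NOT discharged; nothing booked; no mark.
[cite: GrossLMS1991, Prop. 2.1 (2), §10] [cite: McCallumLMS1991, §1 Theorem (Kolyvagin)] -/
theorem sha_three_primary_eq_zero_of_classX11b_of_kodairaNeron_rat_of_not_dvd [NeZero N]
    [W.IsGloballyMinimal] (hW : ClassX11b W 3)
    (hPT : Literature.NumberTheory.GaloisCohomology.poitouTate_sum_localTatePairing_eq_zero K)
    (hN : ∀ [W.IsElliptic], N = W.conductorNorm ℤ)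
    (hrec : heegnerPointOfConductor_one_galoisConj N W K)
    (hCM : ∀ [W.IsElliptic] (_hK : IsImaginaryQuadratic K) (_hH : SatisfiesHeegnerHypothesis N K)
      (Dt : ModularParametrizationData W N) (β : ℤ) (ι : K →+* ℂ),
      (4 * N : ℤ) ∣ β ^ 2 - NumberField.discr K →
      ∀ {M : ℕ}, 1 ≤ M → ∀ (m : ℕ), Squarefree m →
      (∀ q ∈ m.primeFactors, IsKolyvaginPrime N W K 3 q ∧ FrobEqFrobInfty W K (3 ^ M) q) →
      ∃ y : (W.baseChange (ringClassField K ι m)).toAffine.Point,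
        WeierstrassCurve.Affine.Point.map (W' := W) (ringClassField K ι m).subtype.toRatAlgHom y =
          heegnerPointComplexOfConductor Dt (NumberField.discr K) β m)
    (h53 : ∀ [W.IsElliptic] (_hK : IsImaginaryQuadratic K) (_hH : SatisfiesHeegnerHypothesis N K)
      (Dt : ModularParametrizationData W N) (β : ℤ) (ι : K →+* ℂ) {M : ℕ}
      (_hM : 1 ≤ M) {n : ℕ} (_hn : Squarefree n)
      (_hKol : ∀ q ∈ n.primeFactors, IsKolyvaginPrime N W K 3 q ∧ FrobEqFrobInfty W K (3 ^ M) q)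
      (d : (m : ℕ) → m ∣ n → KolyvaginHeegnerData Dt β ι m) (m : ℕ) (hm : m ∣ n)
      (τm : ringClassField K ι m ≃ₐ[ℚ] ringClassField K ι m),
      (∀ x : ringClassField K ι m, ((τm x : ringClassField K ι m) : ℂ) = starRingEnd ℂ x) →
      ∃ σ' ∈ ringClassGal ι m, IsOfFinAddOrder
        (pointGalHom W (ringClassField K ι m) τm (d m hm).y -
          (-W.rootNumber) • pointGalHom W (ringClassField K ι m) σ' (d m hm).y))
    (hKN3m : ∀ [W.IsElliptic] (v : HeightOneSpectrum (𝓞 ℚ)),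
      W.HasMultiplicativeReductionAt v → ¬ 3 ∣ W.ordMinimalDiscriminant v)
    (hKN3a : ∀ [W.IsElliptic] (v : HeightOneSpectrum (𝓞 ℚ)), W.HasAdditiveReductionAt v →
      W.kodairaSymbolAt v ≠ KodairaSymbol.IV ∧ W.kodairaSymbolAt v ≠ KodairaSymbol.IVstar)
    (hγ : ∀ [W.IsElliptic] (_hK : IsImaginaryQuadratic K) (_hH : SatisfiesHeegnerHypothesis N K)
      (Dt : ModularParametrizationData W N) (β : ℤ) (ι : K →+* ℂ) {M : ℕ}
      (_hM : 1 ≤ M) {n : ℕ} (_hn : Squarefree n)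
      (_hKol : ∀ q ∈ n.primeFactors, IsKolyvaginPrime N W K 3 q ∧ FrobEqFrobInfty W K (3 ^ M) q)
      (d : (m : ℕ) → m ∣ n → KolyvaginHeegnerData Dt β ι m)
      (m : ℕ) (hm : m ∣ n) (ℓ : ℕ) (hℓ : ℓ ∈ m.primeFactors) [Fact ℓ.Prime]
      (hΔ : ¬ (ℓ : ℤ) ∣ minimalDiscriminantInt W) (φ₀ : absoluteGaloisGroup (ZMod ℓ)),
      (∀ x : AlgebraicClosure (ZMod ℓ), φ₀ • x = x ^ ℓ) →
      ∀ (hle : ringClassField K ι (m / ℓ) ≤ ringClassField K ι m)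
        (γ : ringClassField K ι m ≃ₐ[ℚ] ringClassField K ι m), γ ∈ ringClassGal ι m →
        geomReduction hΔ ((RatClosure.pointsEquiv (K := K) W).symm
            ((d m hm).toGeomPoints (pointGalHom W (ringClassField K ι m) γ (d m hm).y))) =
          φ₀ • geomReduction hΔ ((RatClosure.pointsEquiv (K := K) W).symm
            ((d m hm).toGeomPoints (pointGalHom W (ringClassField K ι m) γ
              (WeierstrassCurve.Affine.Point.map (W' := W)
                ((RingClassField.inclusion ι hle).restrictScalars ℚ)
                (d (m / ℓ)
                  ((Nat.div_dvd_of_dvd (Nat.dvd_of_mem_primeFactors hℓ)).trans hm)).y))))) :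
    ∀ [W.IsElliptic] (_hK : IsImaginaryQuadratic K) (_hH : SatisfiesHeegnerHypothesis N K)
      {P : (W.baseChange K).toAffine.Point} (_hP : IsHeegnerPoint N W K P)
      (_hnt : ¬ IsOfFinAddOrder P)
      (_h3 : ∀ Q : (W.baseChange K).toAffine.Point, 3 • Q ≠ P) (c : (W.baseChange K).sha),
      (∃ j : ℕ, 3 ^ j • c = 0) → c = 0 := by
  intro _ hK hH P hP hnt h3 c hc
  have h := pow_smul_sha_three_primary_eq_zero_of_classX11b_of_kodairaNeron_rat' hW hPT hN hrec hCM
    h53 hKN3m hKN3a hγ hK hH hP hnt (m := 0) (fun Q ↦ by simpa using h3 Q) c hc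
  simpa using h

/-- **On the class X11b @ 3 ∩ (KN₃)/ℚ: `3^{2·ord_3 [E(K) : ℤ y_K]} · Ш(E/K)[3^∞] = 0`, from FIVE
cite-only inputs AT `3`** — the Heegner-INDEX form (McCallum 1991, §1 Theorem in EXPONENT form
with Lemma 5.1: *"`M₀ = ord_p [E(K) : ℤ y_K]`"*), for `[E(K) : ℤ P]` finite (`_hidx`; the index is
Mathlib's `AddSubgroup.index`, `0` when infinite): `3^{m+1} P' = P` would force
`3^{m+1} ∣ [E(K) : ℤ P]` (tree `X11b.index_zmultiples_zsmul`), so `m = ord_3 [E(K) : ℤ P]` satisfies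
`3^{m+1} ∤ P` and `pow_smul_sha_three_primary_eq_zero_of_classX11b_of_kodairaNeron_rat'` applies.
This is the EXPONENT form, at `p = 3` on this class, of the named fact
`Kolyvagin1990_padicValNat_card_sha_le` (`ord_p #Ш(E/K) ≤ 2 ord_p [E(K) : ℤ y_K]`, ORDER form —
NOT obtained, NOT discharged).  Same binders; CONDITIONAL on EXACTLY {`hPT`, `hrec`, `hCM`, `h53`,
`hγ`} at `3` + `hN` + (KN₃)/ℚ; cite-only; nothing booked; no mark.
[cite: McCallumLMS1991, §1 Theorem (Kolyvagin), Lemma 5.1 (p. 303)] [cite: GrossLMS1991, Thm. 1.3 (2)] -/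
theorem pow_smul_sha_three_primary_eq_zero_of_classX11b_of_kodairaNeron_rat_index [NeZero N]
    [W.IsGloballyMinimal] (hW : ClassX11b W 3)
    (hPT : Literature.NumberTheory.GaloisCohomology.poitouTate_sum_localTatePairing_eq_zero K)
    (hN : ∀ [W.IsElliptic], N = W.conductorNorm ℤ)
    (hrec : heegnerPointOfConductor_one_galoisConj N W K)
    (hCM : ∀ [W.IsElliptic] (_hK : IsImaginaryQuadratic K) (_hH : SatisfiesHeegnerHypothesis N K)
      (Dt : ModularParametrizationData W N) (β : ℤ) (ι : K →+* ℂ),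
      (4 * N : ℤ) ∣ β ^ 2 - NumberField.discr K →
      ∀ {M : ℕ}, 1 ≤ M → ∀ (m : ℕ), Squarefree m →
      (∀ q ∈ m.primeFactors, IsKolyvaginPrime N W K 3 q ∧ FrobEqFrobInfty W K (3 ^ M) q) →
      ∃ y : (W.baseChange (ringClassField K ι m)).toAffine.Point,
        WeierstrassCurve.Affine.Point.map (W' := W) (ringClassField K ι m).subtype.toRatAlgHom y =
          heegnerPointComplexOfConductor Dt (NumberField.discr K) β m)
    (h53 : ∀ [W.IsElliptic] (_hK : IsImaginaryQuadratic K) (_hH : SatisfiesHeegnerHypothesis N K)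
      (Dt : ModularParametrizationData W N) (β : ℤ) (ι : K →+* ℂ) {M : ℕ}
      (_hM : 1 ≤ M) {n : ℕ} (_hn : Squarefree n)
      (_hKol : ∀ q ∈ n.primeFactors, IsKolyvaginPrime N W K 3 q ∧ FrobEqFrobInfty W K (3 ^ M) q)
      (d : (m : ℕ) → m ∣ n → KolyvaginHeegnerData Dt β ι m) (m : ℕ) (hm : m ∣ n)
      (τm : ringClassField K ι m ≃ₐ[ℚ] ringClassField K ι m),
      (∀ x : ringClassField K ι m, ((τm x : ringClassField K ι m) : ℂ) = starRingEnd ℂ x) →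
      ∃ σ' ∈ ringClassGal ι m, IsOfFinAddOrder
        (pointGalHom W (ringClassField K ι m) τm (d m hm).y -
          (-W.rootNumber) • pointGalHom W (ringClassField K ι m) σ' (d m hm).y))
    (hKN3m : ∀ [W.IsElliptic] (v : HeightOneSpectrum (𝓞 ℚ)),
      W.HasMultiplicativeReductionAt v → ¬ 3 ∣ W.ordMinimalDiscriminant v)
    (hKN3a : ∀ [W.IsElliptic] (v : HeightOneSpectrum (𝓞 ℚ)), W.HasAdditiveReductionAt v →
      W.kodairaSymbolAt v ≠ KodairaSymbol.IV ∧ W.kodairaSymbolAt v ≠ KodairaSymbol.IVstar)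
    (hγ : ∀ [W.IsElliptic] (_hK : IsImaginaryQuadratic K) (_hH : SatisfiesHeegnerHypothesis N K)
      (Dt : ModularParametrizationData W N) (β : ℤ) (ι : K →+* ℂ) {M : ℕ}
      (_hM : 1 ≤ M) {n : ℕ} (_hn : Squarefree n)
      (_hKol : ∀ q ∈ n.primeFactors, IsKolyvaginPrime N W K 3 q ∧ FrobEqFrobInfty W K (3 ^ M) q)
      (d : (m : ℕ) → m ∣ n → KolyvaginHeegnerData Dt β ι m)
      (m : ℕ) (hm : m ∣ n) (ℓ : ℕ) (hℓ : ℓ ∈ m.primeFactors) [Fact ℓ.Prime]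
      (hΔ : ¬ (ℓ : ℤ) ∣ minimalDiscriminantInt W) (φ₀ : absoluteGaloisGroup (ZMod ℓ)),
      (∀ x : AlgebraicClosure (ZMod ℓ), φ₀ • x = x ^ ℓ) →
      ∀ (hle : ringClassField K ι (m / ℓ) ≤ ringClassField K ι m)
        (γ : ringClassField K ι m ≃ₐ[ℚ] ringClassField K ι m), γ ∈ ringClassGal ι m →
        geomReduction hΔ ((RatClosure.pointsEquiv (K := K) W).symm
            ((d m hm).toGeomPoints (pointGalHom W (ringClassField K ι m) γ (d m hm).y))) =
          φ₀ • geomReduction hΔ ((RatClosure.pointsEquiv (K := K) W).symm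
            ((d m hm).toGeomPoints (pointGalHom W (ringClassField K ι m) γ
              (WeierstrassCurve.Affine.Point.map (W' := W)
                ((RingClassField.inclusion ι hle).restrictScalars ℚ)
                (d (m / ℓ)
                  ((Nat.div_dvd_of_dvd (Nat.dvd_of_mem_primeFactors hℓ)).trans hm)).y))))) :
    ∀ [W.IsElliptic] (_hK : IsImaginaryQuadratic K) (_hH : SatisfiesHeegnerHypothesis N K)
      {P : (W.baseChange K).toAffine.Point} (_hP : IsHeegnerPoint N W K P)
      (_hnt : ¬ IsOfFinAddOrder P) (_hidx : (AddSubgroup.zmultiples P).index ≠ 0)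
      (c : (W.baseChange K).sha), (∃ j : ℕ, 3 ^ j • c = 0) →
      3 ^ (2 * padicValNat 3 (AddSubgroup.zmultiples P).index) • c = 0 := by
  intro _ hK hH P hP hnt hidx c hc
  set m := padicValNat 3 (AddSubgroup.zmultiples P).index with hm_def
  refine pow_smul_sha_three_primary_eq_zero_of_classX11b_of_kodairaNeron_rat' hW hPT hN hrec hCM
    h53 hKN3m hKN3a hγ hK hH hP hnt (m := m) (fun Q hQ ↦ ?_) c hc
  -- `3^{m+1} Q = P` forces `3^{m+1} ∣ [E(K) : ℤ P]` (McCallum Lemma 5.1), contradicting `m = ord_3`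
  have hQ' : (((3 ^ (m + 1) : ℕ) : ℤ)) • Q = P := by rw [natCast_zsmul]; exact hQ
  have hQinf : ¬ IsOfFinAddOrder Q := fun h ↦ hnt (by rw [← hQ']; exact h.zsmul)
  have hdvd : 3 ^ (m + 1) ∣ (AddSubgroup.zmultiples P).index := by
    refine ⟨(AddSubgroup.zmultiples Q).index, ?_⟩
    conv_lhs => rw [← hQ']
    rw [X11b.index_zmultiples_zsmul hQinf, Int.natAbs_natCast]
  have hle := (padicValNat_dvd_iff_le hidx).mp hdvd
  omega

end Summit.BirchSwinnertonDyer.Rank1Residual.X11b.Three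

end
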